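import Literature.MathematicalPhysics.KineticTheory.CollisionTubeGeometry
import HarnessLib

/-!
# The static collision tube, II: Lebesgue measure in impact coordinates

Topic `Literature/MathematicalPhysics/KineticTheory` (kind proof; companion of
`CollisionTubeGeometry.lean`, wanted by the crux line `even-rung-mean-variance` of
`JParityClosure.EvenStressEnskog`, stmt-AtomisticToContinuum-13079).

The impact normal `n_h` pushes Lebesgue measure restricted to the strict collision tube
`strictTube κ w` (unit diameter, relative velocity `w`, flight-time window `κ`) forward to the measure
`κ (−⟪ν, w⟫)₊ dσ(ν)` on the unit sphere (`map_impactNormal_restrict_strictTube`): this is Boltzmann's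
collision-cylinder change of variables `dq = |⟪ν, w⟫| dσ(ν) dτ` (CIP 1994 App. 4.A; the tree's
`lintegral_collisionCylinder`) integrated over the flight-time window `0 < τ ≤ κ`, using the
parametrisation `q = ν − τ w ↦ (n_h, t_h) = (ν, τ)` of `CollisionTubeGeometry.lean`.  Consequences:

* `lintegral_strictTube_comp_impactNormal`, `integral_strictTube_comp_impactNormal` —
  `∫_{strictTube κ w} Ψ(n_h(q)) dq = ∫_S κ (−⟪ν, w⟫)₊ Ψ(ν) dσ(ν)`;
* `measure_strictTube`, `measure_strictTube_le` — `vol(strictTube κ w) = ∫_S κ(−⟪ν, w⟫)₊ dσ ≤ κ‖w‖σ(S)`;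
* `integral_tubeMark` — `∫ tubeMark κ Ξ q v v' dq = ∫_S κ (⟪v' − v, ν⟫)₊ Ξ(ν, v, v') dσ(ν)`, i.e.
  `κ` times the sphere-integrated mark with the hard-sphere kernel.

## References

* C. Cercignani, R. Illner, M. Pulvirenti, *The Mathematical Theory of Dilute Gases* (1994), §2.2 and
  App. 4.A p. 108 (collision cylinder, `dx = ε^{d−1} |v·n| dσ(n) dτ`).  [CIPDiluteGases1994]
* I. Gallagher, L. Saint-Raymond, B. Texier, *From Newton to Boltzmann* (2013), §4.3.
  [GallagherSaintRaymondTexier2013]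
-/

noncomputable section

open MeasureTheory MeasureTheory.Measure Metric Set
open scoped ENNReal InnerProductSpace Classical
open Literature.Analysis.FluidPDE

namespace Literature.MathematicalPhysics.KineticTheory

variable {E : Type*} [NormedAddCommGroup E] [InnerProductSpace ℝ E]


/-! ## Transfer of two-sided set-wise bounds on a set to integrals -/

section Comparison

variable {α : Type*} [MeasurableSpace α]

/-- **One-sided transfer.**  If `ν(S) ≤ C μ(S)` for all measurable `S ⊆ T` (`C ≥ 0`, `T` of finite
`ν`- and `μ`-measure), then `∫_T g dν ≤ C ∫_T g dμ` for every `μ|_T`-integrable `g ≥ 0`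
(`ν|_T ≤ C μ|_T` as measures). [folklore] -/
theorem setIntegral_le_mul_setIntegral_of_forall_le {ν μ : Measure α} {T : Set α} (hT : MeasurableSet T)
    (hνT : ν T ≠ ∞) (hμT : μ T ≠ ∞) {C : ℝ} (hC : 0 ≤ C)
    (h : ∀ S, MeasurableSet S → S ⊆ T → ν.real S ≤ C * μ.real S)
    {g : α → ℝ} (hg0 : ∀ x, 0 ≤ g x) (hgi : Integrable g (μ.restrict T)) :
    ∫ x in T, g x ∂ν ≤ C * ∫ x in T, g x ∂μ := by
  have hle : ν.restrict T ≤ (ENNReal.ofReal C) • μ.restrict T := by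
    refine Measure.le_iff.2 fun S hS => ?_
    rw [Measure.restrict_apply hS, Measure.smul_apply, Measure.restrict_apply hS, smul_eq_mul]
    have hfinμ : μ (S ∩ T) ≠ ∞ := ((measure_mono inter_subset_right).trans_lt hμT.lt_top).ne
    have hfinν : ν (S ∩ T) ≠ ∞ := ((measure_mono inter_subset_right).trans_lt hνT.lt_top).ne
    have h' := h (S ∩ T) (hS.inter hT) inter_subset_right
    rw [← ENNReal.ofReal_toReal hfinν, ← ENNReal.ofReal_toReal hfinμ, ← ENNReal.ofReal_mul hC]
    exact ENNReal.ofReal_le_ofReal h'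
  calc ∫ x in T, g x ∂ν ≤ ∫ x, g x ∂((ENNReal.ofReal C) • μ.restrict T) :=
        integral_mono_measure hle (ae_of_all _ hg0) (hgi.smul_measure ENNReal.ofReal_ne_top)
    _ = C * ∫ x in T, g x ∂μ := by
        rw [integral_smul_measure, ENNReal.toReal_ofReal hC, smul_eq_mul]

/-- **Two-sided transfer for nonnegative integrands.**  If `|ν(S) − c μ(S)| ≤ e μ(S)` for all
measurable `S ⊆ T`, then `|∫_T g dν − c ∫_T g dμ| ≤ e ∫_T g dμ` for bounded measurable `g ≥ 0`
(no sign assumption on `c`, `e`: the degenerate cases force `T` to be null).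
[folklore] -/
theorem abs_setIntegral_sub_mul_le_of_nonneg {ν μ : Measure α} {T : Set α} (hT : MeasurableSet T)
    (hνT : ν T ≠ ∞) (hμT : μ T ≠ ∞) {c e : ℝ}
    (h : ∀ S, MeasurableSet S → S ⊆ T → |ν.real S - c * μ.real S| ≤ e * μ.real S)
    {g : α → ℝ} (hg : Measurable g) (hg0 : ∀ x, 0 ≤ g x) {B : ℝ} (hB : ∀ x, g x ≤ B) :
    |∫ x in T, g x ∂ν - c * ∫ x in T, g x ∂μ| ≤ e * ∫ x in T, g x ∂μ := by
  have hgb : ∀ x, ‖g x‖ ≤ B := fun x => by rw [Real.norm_eq_abs, abs_of_nonneg (hg0 x)]; exact hB x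
  have hgiμ : Integrable g (μ.restrict T) :=
    Measure.integrableOn_of_bounded hμT hg.aestronglyMeasurable (ae_of_all _ hgb)
  have hgiν : Integrable g (ν.restrict T) :=
    Measure.integrableOn_of_bounded hνT hg.aestronglyMeasurable (ae_of_all _ hgb)
  have hIμ0 : 0 ≤ ∫ x in T, g x ∂μ := integral_nonneg hg0
  have hIν0 : 0 ≤ ∫ x in T, g x ∂ν := integral_nonneg hg0
  by_cases hce : c + e < 0
  · -- degenerate case: `T` is null for both measures
    have hT' := h T hT Subset.rfl
    have hμ0 : μ.real T = 0 := by
      have h1 : ν.real T ≤ (c + e) * μ.real T := by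
        have := (abs_le.1 hT').2; linarith
      have h2 : 0 ≤ ν.real T := measureReal_nonneg
      nlinarith [measureReal_nonneg (μ := μ) (s := T)]
    have hν0 : ν.real T = 0 := by
      have h1 : ν.real T ≤ (c + e) * μ.real T := by
        have := (abs_le.1 hT').2; linarith
      rw [hμ0, mul_zero] at h1
      exact le_antisymm h1 measureReal_nonneg
    have hμT0 : μ.restrict T = 0 := Measure.restrict_eq_zero.2 ((measureReal_eq_zero_iff hμT).1 hμ0)
    have hνT0 : ν.restrict T = 0 := Measure.restrict_eq_zero.2 ((measureReal_eq_zero_iff hνT).1 hν0)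
    rw [hμT0, hνT0, integral_zero_measure, mul_zero, sub_zero, abs_zero, mul_zero]
  push Not at hce
  -- upper bound
  have hup : ∫ x in T, g x ∂ν ≤ (c + e) * ∫ x in T, g x ∂μ :=
    setIntegral_le_mul_setIntegral_of_forall_le hT hνT hμT hce (fun S hS hST => by
      have := (abs_le.1 (h S hS hST)).2; linarith) hg0 hgiμ
  -- lower bound
  have hlow : (c - e) * ∫ x in T, g x ∂μ ≤ ∫ x in T, g x ∂ν := by
    by_cases hcme : c - e ≤ 0
    · exact (mul_nonpos_of_nonpos_of_nonneg hcme hIμ0).trans hIν0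
    · push Not at hcme
      have hinv : 0 ≤ (c - e)⁻¹ := inv_nonneg.2 hcme.le
      have h' : ∫ x in T, g x ∂μ ≤ (c - e)⁻¹ * ∫ x in T, g x ∂ν :=
        setIntegral_le_mul_setIntegral_of_forall_le hT hμT hνT hinv (fun S hS hST => by
          have h1 := (abs_le.1 (h S hS hST)).1
          rw [le_inv_mul_iff₀ hcme]
          linarith) hg0 hgiν
      have := mul_le_mul_of_nonneg_left h' hcme.le
      rwa [← mul_assoc, mul_inv_cancel₀ hcme.ne', one_mul] at this
  rw [abs_le]
  constructor <;> linarith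

/-- **Two-sided transfer of set-wise bounds to integrals.**  If `|ν(S) − c μ(S)| ≤ e μ(S)` for
all measurable `S ⊆ T` (`T` of finite `ν`- and `μ`-measure), then for every bounded measurable real
`f`, `|∫_T f dν − c ∫_T f dμ| ≤ e ∫_T |f| dμ` (split `f = f⁺ − f⁻`). [folklore] -/
theorem abs_setIntegral_sub_mul_setIntegral_le {ν μ : Measure α} {T : Set α} (hT : MeasurableSet T)
    (hνT : ν T ≠ ∞) (hμT : μ T ≠ ∞) {c e : ℝ}
    (h : ∀ S, MeasurableSet S → S ⊆ T → |ν.real S - c * μ.real S| ≤ e * μ.real S)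
    {f : α → ℝ} (hf : Measurable f) {B : ℝ} (hB : ∀ x, |f x| ≤ B) :
    |∫ x in T, f x ∂ν - c * ∫ x in T, f x ∂μ| ≤ e * ∫ x in T, |f x| ∂μ := by
  set fp : α → ℝ := fun x => max (f x) 0 with hfp
  set fm : α → ℝ := fun x => max (-f x) 0 with hfm
  have hfpm : Measurable fp := hf.max measurable_const
  have hfmm : Measurable fm := hf.neg.max measurable_const
  have hfp0 : ∀ x, 0 ≤ fp x := fun x => le_max_right _ _
  have hfm0 : ∀ x, 0 ≤ fm x := fun x => le_max_right _ _
  have hfpB : ∀ x, fp x ≤ B := fun x => max_le ((le_abs_self _).trans (hB x)) ((abs_nonneg _).trans (hB x))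
  have hfmB : ∀ x, fm x ≤ B := fun x => max_le ((neg_le_abs _).trans (hB x)) ((abs_nonneg _).trans (hB x))
  have hsub : ∀ x, f x = fp x - fm x := fun x => (max_zero_sub_max_neg_zero_eq_self (f x)).symm
  have habs : ∀ x, |f x| = fp x + fm x := fun x => (max_zero_add_max_neg_zero_eq_abs_self (f x)).symm
  have hfb : ∀ x, ‖f x‖ ≤ B := fun x => by rw [Real.norm_eq_abs]; exact hB x
  have hint : ∀ {ρ : Measure α}, ρ T ≠ ∞ → Integrable fp (ρ.restrict T) ∧ Integrable fm (ρ.restrict T) := by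
    intro ρ hρ
    have hfi : Integrable f (ρ.restrict T) :=
      Measure.integrableOn_of_bounded hρ hf.aestronglyMeasurable (ae_of_all _ hfb)
    exact ⟨(hfi.sup (integrable_zero _ _ _)).congr (ae_of_all _ fun x => rfl),
      (hfi.neg.sup (integrable_zero _ _ _)).congr (ae_of_all _ fun x => rfl)⟩
  obtain ⟨hpν, hmν⟩ := hint hνT
  obtain ⟨hpμ, hmμ⟩ := hint hμT
  have eν : ∫ x in T, f x ∂ν = (∫ x in T, fp x ∂ν) - ∫ x in T, fm x ∂ν := by
    rw [← integral_sub hpν hmν]; exact integral_congr_ae (ae_of_all _ hsub)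
  have eμ : ∫ x in T, f x ∂μ = (∫ x in T, fp x ∂μ) - ∫ x in T, fm x ∂μ := by
    rw [← integral_sub hpμ hmμ]; exact integral_congr_ae (ae_of_all _ hsub)
  have eabs : ∫ x in T, |f x| ∂μ = (∫ x in T, fp x ∂μ) + ∫ x in T, fm x ∂μ := by
    rw [← integral_add hpμ hmμ]; exact integral_congr_ae (ae_of_all _ habs)
  have hp := abs_setIntegral_sub_mul_le_of_nonneg hT hνT hμT h hfpm hfp0 hfpB
  have hm := abs_setIntegral_sub_mul_le_of_nonneg hT hνT hμT h hfmm hfm0 hfmB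
  rw [eν, eμ, eabs]
  calc |(∫ x in T, fp x ∂ν) - (∫ x in T, fm x ∂ν) - c * ((∫ x in T, fp x ∂μ) - ∫ x in T, fm x ∂μ)|
      = |((∫ x in T, fp x ∂ν) - c * ∫ x in T, fp x ∂μ) - ((∫ x in T, fm x ∂ν) - c * ∫ x in T, fm x ∂μ)| := by
        ring_nf
    _ ≤ |(∫ x in T, fp x ∂ν) - c * ∫ x in T, fp x ∂μ| + |(∫ x in T, fm x ∂ν) - c * ∫ x in T, fm x ∂μ| :=
        abs_sub _ _
    _ ≤ e * (∫ x in T, fp x ∂μ) + e * ∫ x in T, fm x ∂μ := add_le_add hp hm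
    _ = e * ((∫ x in T, fp x ∂μ) + ∫ x in T, fm x ∂μ) := by ring

end Comparison

/-! ## Lebesgue measure on the strict tube in impact coordinates -/

section MeasureSec

variable [FiniteDimensional ℝ E] [MeasurableSpace E] [BorelSpace E] (μ : Measure E) [μ.IsAddHaarMeasure]

/-- The density `κ (−⟪ν, w⟫)₊` on the unit sphere (height of the collision cylinder over `dσ(ν)` per
unit of flight-time window). [cite: CIPDiluteGases1994, App. 4.A] -/
def tubeDensity (κ : ℝ) (w : E) (ν : sphere (0 : E) 1) : ℝ≥0∞ :=
  ENNReal.ofReal (κ * max (-⟪(ν : E), w⟫_ℝ) 0)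

omit [FiniteDimensional ℝ E] in
/-- The tube density is measurable. [folklore] -/
theorem measurable_tubeDensity (κ : ℝ) (w : E) : Measurable (tubeDensity κ w) := by
  unfold tubeDensity; fun_prop

omit [FiniteDimensional ℝ E] [MeasurableSpace E] [BorelSpace E] in
/-- The tube density is at most `κ ‖w‖` (`κ ≥ 0`). [folklore] -/
theorem tubeDensity_le {κ : ℝ} (hκ : 0 ≤ κ) (w : E) (ν : sphere (0 : E) 1) :
    tubeDensity κ w ν ≤ ENNReal.ofReal (κ * ‖w‖) := by
  unfold tubeDensity
  refine ENNReal.ofReal_le_ofReal (mul_le_mul_of_nonneg_left (max_le ?_ (norm_nonneg _)) hκ)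
  have hν : ‖(ν : E)‖ = 1 := by simp
  calc -⟪(ν : E), w⟫_ℝ ≤ |⟪(ν : E), w⟫_ℝ| := neg_le_abs _
    _ ≤ ‖(ν : E)‖ * ‖w‖ := abs_real_inner_le_norm _ _
    _ = ‖w‖ := by rw [hν, one_mul]

variable [Nontrivial E]

/-- **Lebesgue measure on the strict tube in impact coordinates**: the impact normal pushes
`μ|strictTube κ w` forward to `κ (−⟪ν, w⟫)₊ dσ(ν)` on the unit sphere (collision-cylinder formula
`dq = |⟪ν, w⟫| dσ(ν) dτ`, integrated over the flight-time window `0 < τ ≤ κ`). [cite: CIPDiluteGases1994, App. 4.A] -/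
theorem map_impactNormal_restrict_strictTube {κ : ℝ} (hκ : 0 ≤ κ) (w : E) :
    (μ.restrict (strictTube κ w)).map (impactNormal w) =
      (μ.toSphere.withDensity (tubeDensity κ w)).map ((↑) : sphere (0 : E) 1 → E) := by
  ext A hA
  set T := strictTube κ w with hT
  have hTA : MeasurableSet (impactNormal w ⁻¹' A ∩ T) :=
    ((measurable_impactNormal w) hA).inter (measurableSet_strictTube κ w)
  have hsub : impactNormal w ⁻¹' A ∩ T ⊆ collisionCylRegion 1 (-w) :=
    fun q hq => strictTube_subset_collisionCylRegion κ w hq.2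
  rw [map_apply (measurable_impactNormal w) hA, restrict_apply' (measurableSet_strictTube κ w),
    map_apply measurable_subtype_coe hA, withDensity_apply _ (measurable_subtype_coe hA),
    ← lintegral_indicator (measurable_subtype_coe hA)]
  have h1 : μ (impactNormal w ⁻¹' A ∩ T) =
      ∫⁻ r in collisionCylRegion (1 : ℝ) (-w), (impactNormal w ⁻¹' A ∩ T).indicator 1 r ∂μ := by
    rw [lintegral_indicator_one hTA, restrict_apply hTA, inter_eq_left.2 hsub]
  rw [h1, lintegral_collisionCylinder μ one_pos (-w) _ (measurable_one.indicator hTA)]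
  refine lintegral_congr fun ν => ?_
  have hν : ‖(ν : E)‖ = 1 := by simp
  by_cases hdom : (ν : E) ∈ collisionCylDom (-w)
  · have hνw : ⟪(ν : E), w⟫_ℝ < 0 := by
      have h := hdom
      rw [mem_collisionCylDom, inner_neg_left, real_inner_comm] at h
      linarith
    have hinner : ∀ τ ∈ Ioi (0 : ℝ),
        (collisionCylDom (-w)).indicator (fun _ => (1 : ℝ≥0∞)) (ν : E) *
          (ENNReal.ofReal ((1 : ℝ) ^ (Module.finrank ℝ E - 1) * ⟪-w, (ν : E)⟫_ℝ) *
            (impactNormal w ⁻¹' A ∩ T).indicator 1 ((1 : ℝ) • (ν : E) + τ • (-w))) =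
        ENNReal.ofReal (-⟪(ν : E), w⟫_ℝ) * A.indicator 1 (ν : E) * (Iic κ).indicator 1 τ := by
      intro τ hτ
      have hτ0 : 0 < τ := hτ
      rw [indicator_of_mem hdom, one_mul, one_pow, one_mul, one_smul, smul_neg, ← sub_eq_add_neg,
        inner_neg_left, real_inner_comm, mul_assoc]
      congr 1
      by_cases hτκ : τ ≤ κ
      · have hmem : (ν : E) - τ • w ∈ impactNormal w ⁻¹' A ∩ T ↔ (ν : E) ∈ A := by
          rw [mem_inter_iff, mem_preimage, impactNormal_sub_smul hν hνw τ,
            sub_smul_mem_strictTube_iff hν hνw hτ0]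
          exact ⟨fun h => h.1, fun h => ⟨h, hτκ⟩⟩
        rw [indicator_of_mem (show τ ∈ Iic κ from hτκ), Pi.one_apply, mul_one]
        by_cases hA' : (ν : E) ∈ A
        · rw [indicator_of_mem (hmem.2 hA'), indicator_of_mem hA', Pi.one_apply, Pi.one_apply]
        · rw [indicator_of_notMem (fun h => hA' (hmem.1 h)), indicator_of_notMem hA']
      · rw [indicator_of_notMem (show τ ∉ Iic κ from hτκ), mul_zero, indicator_of_notMem]
        exact fun h => hτκ ((sub_smul_mem_strictTube_iff hν hνw hτ0).1 h.2)
    rw [setLIntegral_congr_fun measurableSet_Ioi hinner,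
      lintegral_const_mul _ (measurable_one.indicator measurableSet_Iic),
      lintegral_indicator_one measurableSet_Iic, Measure.restrict_apply measurableSet_Iic, Iic_inter_Ioi,
      Real.volume_Ioc, sub_zero]
    by_cases hA' : (ν : E) ∈ A
    · rw [indicator_of_mem hA', indicator_of_mem (show ν ∈ ((↑) : sphere (0 : E) 1 → E) ⁻¹' A from hA'),
        Pi.one_apply, mul_one, tubeDensity, max_eq_left (by linarith), ENNReal.ofReal_mul hκ, mul_comm]
    · rw [indicator_of_notMem hA', indicator_of_notMem
        (show ν ∉ ((↑) : sphere (0 : E) 1 → E) ⁻¹' A from hA'), mul_zero, zero_mul]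
  · have hνw : 0 ≤ ⟪(ν : E), w⟫_ℝ := by
      have h := hdom
      rw [mem_collisionCylDom, inner_neg_left, real_inner_comm, not_lt] at h
      linarith
    have h0 : tubeDensity κ w ν = 0 := by
      rw [tubeDensity, max_eq_right (by linarith), mul_zero, ENNReal.ofReal_zero]
    simp only [indicator_of_notMem hdom, zero_mul, lintegral_const, zero_mul]
    by_cases hA' : (ν : E) ∈ A
    · rw [indicator_of_mem (show ν ∈ ((↑) : sphere (0 : E) 1 → E) ⁻¹' A from hA'), h0]
    · rw [indicator_of_notMem (show ν ∉ ((↑) : sphere (0 : E) 1 → E) ⁻¹' A from hA')]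

/-- **Change of variables on the strict tube** (`lintegral` form): for measurable `G ≥ 0`,
`∫⁻_{strictTube κ w} G(n_h(q)) dq = ∫⁻_S κ(−⟪ν, w⟫)₊ G(ν) dσ(ν)`. [cite: CIPDiluteGases1994, App. 4.A] -/
theorem lintegral_strictTube_comp_impactNormal {κ : ℝ} (hκ : 0 ≤ κ) (w : E) {G : E → ℝ≥0∞}
    (hG : Measurable G) :
    ∫⁻ q in strictTube κ w, G (impactNormal w q) ∂μ = ∫⁻ ν, tubeDensity κ w ν * G ν ∂μ.toSphere := by
  rw [← lintegral_map hG (measurable_impactNormal w), map_impactNormal_restrict_strictTube μ hκ w,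
    lintegral_map hG measurable_subtype_coe]
  exact lintegral_withDensity_eq_lintegral_mul _ (measurable_tubeDensity κ w) (hG.comp measurable_subtype_coe)

/-- **Volume of the strict tube**: `vol(strictTube κ w) = ∫_S κ(−⟪ν, w⟫)₊ dσ(ν)` (`= κ π ‖w‖` in
`ℝ³`). [cite: CIPDiluteGases1994, App. 4.A] -/
theorem measure_strictTube {κ : ℝ} (hκ : 0 ≤ κ) (w : E) :
    μ (strictTube κ w) = ∫⁻ ν, tubeDensity κ w ν ∂μ.toSphere := by
  have h := lintegral_strictTube_comp_impactNormal μ hκ w (G := fun _ => 1) measurable_const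
  simpa only [mul_one, lintegral_const, Measure.restrict_apply MeasurableSet.univ, univ_inter,
    one_mul] using h

/-- **The strict tube is thin**: `vol(strictTube κ w) ≤ κ ‖w‖ σ(S)`. [cite: CIPDiluteGases1994, §2.2] -/
theorem measure_strictTube_le {κ : ℝ} (hκ : 0 ≤ κ) (w : E) :
    μ (strictTube κ w) ≤ ENNReal.ofReal (κ * ‖w‖) * μ.toSphere univ := by
  rw [measure_strictTube μ hκ w]
  calc ∫⁻ ν, tubeDensity κ w ν ∂μ.toSphere ≤ ∫⁻ _ν, ENNReal.ofReal (κ * ‖w‖) ∂μ.toSphere :=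
        lintegral_mono fun ν => tubeDensity_le hκ w ν
    _ = ENNReal.ofReal (κ * ‖w‖) * μ.toSphere univ := lintegral_const _

/-- **Change of variables on the strict tube** (Bochner form): for measurable real `Ψ`,
`∫_{strictTube κ w} Ψ(n_h(q)) dq = ∫_S κ(−⟪ν, w⟫)₊ Ψ(ν) dσ(ν)` (both sides with the Bochner junk
convention). [cite: CIPDiluteGases1994, App. 4.A] -/
theorem integral_strictTube_comp_impactNormal [SecondCountableTopology E] {κ : ℝ} (hκ : 0 ≤ κ) (w : E)
    {Ψ : E → ℝ} (hΨ : Measurable Ψ) :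
    ∫ q in strictTube κ w, Ψ (impactNormal w q) ∂μ =
      ∫ ν, (κ * max (-⟪(ν : E), w⟫_ℝ) 0) * Ψ ν ∂μ.toSphere := by
  rw [← integral_map (measurable_impactNormal w).aemeasurable hΨ.aestronglyMeasurable,
    map_impactNormal_restrict_strictTube μ hκ w,
    integral_map measurable_subtype_coe.aemeasurable hΨ.aestronglyMeasurable,
    integral_withDensity_eq_integral_toReal_smul (measurable_tubeDensity κ w)
      (ae_of_all _ fun _ => ENNReal.ofReal_lt_top)]
  refine integral_congr_ae (ae_of_all _ fun ν => ?_)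
  dsimp only [tubeDensity]
  rw [ENNReal.toReal_ofReal (mul_nonneg hκ (le_max_right _ _)), smul_eq_mul]

end MeasureSec

/-! ## The space integral of the tube mark -/

/-- The tube mark as an indicator of the strict tube. [folklore] -/
theorem tubeMark_eq_indicator (κ : ℝ) (Ξ : E × E × E → ℝ) (v v' : E) :
    (fun q => tubeMark κ Ξ q v v') =
      (strictTube κ (v - v')).indicator fun q => Ξ (impactNormal (v - v') q, v, v') := by
  funext q
  simp only [tubeMark, Set.indicator_apply]

section MarkIntegral

variable [FiniteDimensional ℝ E] [MeasurableSpace E] [BorelSpace E] [Nontrivial E]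
  (μ : Measure E) [μ.IsAddHaarMeasure]

/-- **The space integral of the tube mark**: `∫ tubeMark κ Ξ q v v' dq = ∫_S κ (⟪v' − v, ν⟫)₊ Ξ(ν, v, v') dσ(ν)`
— `κ` times the sphere-integrated mark with the hard-sphere kernel (`κ ≥ 0`, `Ξ` measurable).
[cite: CIPDiluteGases1994, §2.2] -/
theorem integral_tubeMark {κ : ℝ} (hκ : 0 ≤ κ) {Ξ : E × E × E → ℝ} (hΞ : Measurable Ξ) (v v' : E) :
    ∫ q, tubeMark κ Ξ q v v' ∂μ =
      ∫ ν, (κ * max ⟪v' - v, (ν : E)⟫_ℝ 0) * Ξ ((ν : E), v, v') ∂μ.toSphere := by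
  have hΨ : Measurable fun n : E => Ξ (n, v, v') := hΞ.comp (measurable_id.prodMk measurable_const)
  rw [show (fun q => tubeMark κ Ξ q v v') = _ from tubeMark_eq_indicator κ Ξ v v',
    integral_indicator (measurableSet_strictTube κ (v - v')),
    integral_strictTube_comp_impactNormal μ hκ (v - v') hΨ]
  refine integral_congr_ae (ae_of_all _ fun ν => ?_)
  dsimp only
  rw [← inner_neg_right, neg_sub, real_inner_comm]

end MarkIntegral

end Literature.MathematicalPhysics.KineticTheory

end
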